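import Literature.NumberTheory.Automorphic.IdeleClassCharacterExtension
import Literature.NumberTheory.GaloisRepresentations.HeckeCharacterArchExistence
import Literature.GroupTheory.SubgroupSupGluing
import Literature.Analysis.Complex.AngularPart
import Mathlib.NumberTheory.NumberField.InfiniteAdeleRing
import Mathlib.Analysis.Complex.Circle
import HarnessLib

/-!
# Unitary ∞-types of idele class characters, and extension with prescribed ∞-type

Topic `NumberTheory/Automorphic`; namespace `Literature.NumberTheory.Automorphic` (sub-namespaces
`InfiniteAdeleRing`, `IdeleClassGroup` after the objects). `K` a number field,
`K_∞ = InfiniteAdeleRing K`, `C_K = IdeleClassGroup K`; the angular part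
`Complex.unitPart : ℂˣ →* S¹` is `Literature/Analysis/Complex/AngularPart.lean`.

* `InfiniteAdeleRing.infLocalUnits K v : (K_∞)ˣ →* ℂˣ` — the `v`-component read in `ℂ` through
  `extensionEmbedding v` (real-valued at a real place); `InfiniteAdeleRing.singleUnits K v` — the
  infinite idele concentrated at `v`;
* `infinityTypeChar K e : (K_∞)ˣ →* S¹`, `u ↦ ∏_v (u_v/‖u_v‖)^{e_v}` for `e : InfinitePlace K → ℤ` —
  the unitary character of ∞-type `e` (continuous); it is the tree's
  `GaloisRepresentations.InfiniteIdele.unitaryArchChar e 0`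
  (`coe_infinityTypeChar_eq_unitaryArchChar`);
  **`infinityTypeChar_injective_of_isComplex`**: at a complex place the exponent `e_v` is determined
  by the character;
* `IdeleClassGroup.HasInfinityType ψ e` for `ψ : C_K →ₜ* S¹` —
  `ψ ∘ [K_∞ˣ → C_K] = infinityTypeChar e` (`hasInfinityType_iff`,
  `infinityType_unique_of_isComplex`);
* **`IdeleClassGroup.exists_ideleClassChar_of_infinityType`**: if `B ≤ C_K` contains the classes
  of `K_∞ˣ` and `χ : B →* S¹` is continuous with `χ|_{K_∞ˣ}` of ∞-type `e`, then `χ` is the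
  restriction of a continuous unitary character of `C_K` of ∞-type `e`
  (`IdeleClassCharacterExtension.lean`);
* `IdeleClassGroup.exists_char_sup_infUnits_of_compatible` /
  **`IdeleClassGroup.exists_ideleClassChar_of_compatible`**: for ANY `H ≤ C_K` and `χ₁ : H →* S¹`
  agreeing with the ∞-type character `e` on `H ⊓ [K_∞ˣ]`, the two glue to a character of
  `H ⊔ [K_∞ˣ]` (`Literature/GroupTheory/SubgroupSupGluing.lean`), which — if continuous — extends to
  a continuous unitary character of `C_K` of ∞-type `e` restricting to `χ₁`.

Standard (A. Weil, "On a certain type of characters of the idèle-class group of an algebraic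
number-field" (1956), §1; J. Tate, thesis, §4 [WeilBNT1967, TateThesis1967]); everything is
proved.

## Provenance

Reproduced for the tree under the LEAN-IN-TREE rule (2026-08-18) from the pub-hodgecm cell's
package files `HodgeCM/PerL34/InfinityType.lean` §§2–4 (DAG-node prover #10 lineage, seat pv10,
gate run 22; 245 lines) and `HodgeCM/PerL34/CharacterGluing.lean` §3 (run 21), re-based on the
tree's `IdeleClassGroup K` (`UnitaryHeckeCharacter K` ↦ `IdeleClassGroup K →ₜ* Circle`,
`NumberField.X` ↦ `Literature.NumberTheory.Automorphic.X`), plus the bridge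
`coe_infinityTypeChar_eq_unitaryArchChar` to the tree's archimedean parameters; otherwise verbatim
with added docstrings.
-/

set_option autoImplicit false

noncomputable section

open _root_.Topology
open Literature.Analysis

namespace Literature.NumberTheory.Automorphic

/-! ## ∞-components and unitary ∞-types -/

open NumberField NumberField.InfinitePlace NumberField.InfinitePlace.Completion

section components

variable (K : Type*) [Field K]

namespace InfiniteAdeleRing

/-- Evaluation of an infinite adele at the infinite place `v` (`Pi.evalRingHom`). [folklore] -/
def evalRingHom (v : InfinitePlace K) : InfiniteAdeleRing K →+* v.Completion :=
  Pi.evalRingHom (fun w : InfinitePlace K => w.Completion) v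

/-- `evalRingHom v x = x v`. [folklore] -/
@[simp] theorem evalRingHom_apply (v : InfinitePlace K) (x : InfiniteAdeleRing K) :
    evalRingHom K v x = x v := rfl

/-- `evalRingHom v` is continuous. [folklore] -/
theorem continuous_evalRingHom (v : InfinitePlace K) : Continuous (evalRingHom K v) :=
  continuous_apply v

/-- The `v`-component of an infinite idele, read in `ℂ` through the canonical embedding
`K_v →+* ℂ` (`extensionEmbedding`): `(K_∞)ˣ →* ℂˣ`. [folklore] -/
def infLocalUnits (v : InfinitePlace K) : (InfiniteAdeleRing K)ˣ →* ℂˣ :=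
  (Units.map (extensionEmbedding v).toMonoidHom).comp (Units.map (evalRingHom K v).toMonoidHom)

/-- `infLocalUnits v u = ι_v (u_v)` in `ℂ`. [folklore] -/
@[simp] theorem coe_infLocalUnits (v : InfinitePlace K) (u : (InfiniteAdeleRing K)ˣ) :
    (infLocalUnits K v u : ℂ) = extensionEmbedding v ((u : InfiniteAdeleRing K) v) := rfl

/-- `infLocalUnits v` is continuous. [folklore] -/
theorem continuous_infLocalUnits (v : InfinitePlace K) : Continuous (infLocalUnits K v) :=
  (Continuous.units_map _ (isometry_extensionEmbedding v).continuous).comp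
    (Continuous.units_map _ (continuous_evalRingHom K v))

/-- At a real place the `ℂ`-valued component is real. [folklore] -/
theorem infLocalUnits_mem_real {v : InfinitePlace K} (hv : v.IsReal)
    (u : (InfiniteAdeleRing K)ˣ) : ∃ r : ℝ, (infLocalUnits K v u : ℂ) = r :=
  ⟨extensionEmbeddingOfIsReal hv ((u : InfiniteAdeleRing K) v), by
    rw [coe_infLocalUnits, extensionEmbeddingOfIsReal_apply]⟩

open scoped Classical in
/-- The infinite idele which is `c` at `v` and `1` elsewhere. [folklore] -/
def singleUnits (v : InfinitePlace K) : (v.Completion)ˣ →* (InfiniteAdeleRing K)ˣ :=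
  Units.map (MonoidHom.mulSingle (fun w : InfinitePlace K => w.Completion) v)

open scoped Classical in
/-- `(singleUnits v c) v = c`. [folklore] -/
theorem singleUnits_apply_self (v : InfinitePlace K) (c : (v.Completion)ˣ) :
    ((singleUnits K v c : (InfiniteAdeleRing K)ˣ) : InfiniteAdeleRing K) v = c := by
  show (Pi.mulSingle (M := fun w : InfinitePlace K => w.Completion) v (c : v.Completion)) v = c
  exact Pi.mulSingle_eq_same v _

open scoped Classical in
/-- `(singleUnits v c) w = 1` for `w ≠ v`. [folklore] -/
theorem singleUnits_apply_of_ne (v : InfinitePlace K) (c : (v.Completion)ˣ) {w : InfinitePlace K}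
    (hw : w ≠ v) : ((singleUnits K v c : (InfiniteAdeleRing K)ˣ) : InfiniteAdeleRing K) w = 1 := by
  show (Pi.mulSingle (M := fun w : InfinitePlace K => w.Completion) v (c : v.Completion)) w = 1
  exact Pi.mulSingle_eq_of_ne hw _

end InfiniteAdeleRing

end components

open InfiniteAdeleRing

section infinityType

variable (K : Type*) [Field K] [NumberField K]

/-- The unitary character of `(K_∞)ˣ` of ∞-type `e`: `u ↦ ∏_v (u_v/‖u_v‖)^{e_v}`.
[cite: WeilBNT1967, Ch. VII §3] -/
def infinityTypeChar (e : InfinitePlace K → ℤ) : (InfiniteAdeleRing K)ˣ →* Circle where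
  toFun u := ∏ v : InfinitePlace K, Complex.unitPart (infLocalUnits K v u) ^ e v
  map_one' := by simp
  map_mul' x y := by
    simp only [map_mul, mul_zpow, Finset.prod_mul_distrib]

/-- Unfolding `infinityTypeChar`. [folklore] -/
theorem infinityTypeChar_apply (e : InfinitePlace K → ℤ) (u : (InfiniteAdeleRing K)ˣ) :
    infinityTypeChar K e u =
      ∏ v : InfinitePlace K, Complex.unitPart (infLocalUnits K v u) ^ e v :=
  rfl

/-- `infinityTypeChar e` is continuous. [folklore] -/
theorem continuous_infinityTypeChar (e : InfinitePlace K → ℤ) :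
    Continuous (infinityTypeChar K e) := by
  show Continuous fun u => ∏ v : InfinitePlace K, Complex.unitPart (infLocalUnits K v u) ^ e v
  refine continuous_finsetProd _ fun v _ => ?_
  exact (Complex.continuous_unitPart.comp (continuous_infLocalUnits K v)).zpow (e v)

/-- **Bridge to the tree's archimedean parameters**: `infinityTypeChar e` is
`InfiniteIdele.unitaryArchChar e 0` (`HeckeCharacterArchExistence.lean`: the unitary archimedean
character with parameters `(m, t) = (e, 0)`). [folklore] -/
theorem coe_infinityTypeChar_eq_unitaryArchChar (e : InfinitePlace K → ℤ)
    (u : (InfiniteAdeleRing K)ˣ) :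
    (infinityTypeChar K e u : ℂ) = GaloisRepresentations.InfiniteIdele.unitaryArchChar e 0 u := by
  rw [infinityTypeChar_apply, GaloisRepresentations.InfiniteIdele.unitaryArchChar,
    ← Circle.coeHom_apply, map_prod]
  refine Finset.prod_congr rfl fun v _ => ?_
  rw [Circle.coeHom_apply, Circle.coe_zpow, Complex.coe_unitPart, coe_infLocalUnits,
    Pi.zero_apply, Complex.ofReal_zero, zero_mul, Complex.cpow_zero, mul_one]

/-- The value of the ∞-type character on an idele concentrated at one place. [folklore] -/
theorem infinityTypeChar_singleUnits (e : InfinitePlace K → ℤ) (v : InfinitePlace K)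
    (c : (v.Completion)ˣ) :
    infinityTypeChar K e (singleUnits K v c) =
      Complex.unitPart (Units.map (extensionEmbedding v).toMonoidHom c) ^ e v := by
  classical
  rw [infinityTypeChar_apply, Finset.prod_eq_single v]
  · congr 2
    ext
    simp [singleUnits_apply_self]
  · intro w _ hw
    have : infLocalUnits K w (singleUnits K v c) = 1 := by
      ext
      simp [singleUnits_apply_of_ne K v c hw]
    rw [this, map_one, one_zpow]
  · intro h; exact absurd (Finset.mem_univ v) h

/-- **The ∞-type at a complex place is determined by the ∞-type character.**
[cite: WeilBNT1967, Ch. VII §3] -/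
theorem infinityTypeChar_injective_of_isComplex {e e' : InfinitePlace K → ℤ}
    (h : infinityTypeChar K e = infinityTypeChar K e') {v : InfinitePlace K} (hv : v.IsComplex) :
    e v = e' v := by
  by_contra hne
  have hd : e v - e' v ≠ 0 := sub_ne_zero.mpr hne
  obtain ⟨ζ, hζ1, hζd⟩ := Complex.exists_norm_eq_one_zpow_ne_one hd
  have hζ0 : ζ ≠ 0 := fun h0 => by simp [h0] at hζ1
  obtain ⟨c, hc⟩ := surjective_extensionEmbedding_of_isComplex hv ζ
  have hc0 : c ≠ 0 := fun h0 => hζ0 (by rw [← hc, h0, map_zero])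
  let cu : (v.Completion)ˣ := Units.mk0 c hc0
  have hval : (Complex.unitPart (Units.map (extensionEmbedding v).toMonoidHom cu) : ℂ) = ζ := by
    rw [Complex.coe_unitPart]
    have : ((Units.map (extensionEmbedding v).toMonoidHom cu : ℂˣ) : ℂ) = ζ := hc
    rw [this, hζ1]
    simp
  have key := congrArg
    (fun f : (InfiniteAdeleRing K)ˣ →* Circle => (f (singleUnits K v cu) : ℂ)) h
  simp only [infinityTypeChar_singleUnits, Circle.coe_zpow, hval] at key
  apply hζd
  calc ζ ^ (e v - e' v) = ζ ^ e v / ζ ^ e' v := zpow_sub₀ hζ0 _ _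
    _ = 1 := by rw [key, div_self (zpow_ne_zero _ hζ0)]

end infinityType

/-! ## ∞-types of unitary idele class characters -/

namespace IdeleClassGroup

variable (K : Type) [Field K] [NumberField K]

/-- A continuous unitary character `ψ : C_K → S¹` has (unitary) ∞-type `e` when its restriction
to `K_∞ˣ` is `u ↦ ∏_v (u_v/‖u_v‖)^{e_v}`. [cite: WeilBNT1967, Ch. VII §3] -/
def HasInfinityType (ψ : IdeleClassGroup K →ₜ* Circle) (e : InfinitePlace K → ℤ) : Prop :=
  ∀ u : (InfiniteAdeleRing K)ˣ, ψ (infUnitsToClass K u) = infinityTypeChar K e u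

/-- **Extension with prescribed ∞-type.** Let `B ≤ C_K` contain the classes of `K_∞ˣ` and let
`χ : B →* S¹` be continuous with restriction to `K_∞ˣ` the ∞-type character `e`. Then `χ` is the
restriction of a continuous unitary character of `C_K` of ∞-type `e`.
[cite: WeilBNT1967, Ch. VII §3] -/
theorem exists_ideleClassChar_of_infinityType (B : Subgroup (IdeleClassGroup K))
    (hNB : ∀ x : (InfiniteAdeleRing K)ˣ, infUnitsToClass K x ∈ B) (χ : B →* Circle)
    (hχ : Continuous χ) (e : InfinitePlace K → ℤ)
    (hχe : ∀ u : (InfiniteAdeleRing K)ˣ, χ ⟨infUnitsToClass K u, hNB u⟩ = infinityTypeChar K e u) :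
    ∃ ψ : IdeleClassGroup K →ₜ* Circle,
      HasInfinityType K ψ e ∧ ∀ b : B, ψ (b : IdeleClassGroup K) = χ b := by
  obtain ⟨ψ, hψ⟩ := exists_ideleClassChar_extension_of_continuous K B hNB χ hχ
  refine ⟨ψ, fun u => ?_, hψ⟩
  rw [← hχe u]
  exact hψ ⟨infUnitsToClass K u, hNB u⟩

/-- `HasInfinityType` as an identity of homomorphisms `(K_∞)ˣ →* S¹`. [folklore] -/
theorem hasInfinityType_iff (ψ : IdeleClassGroup K →ₜ* Circle) (e : InfinitePlace K → ℤ) :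
    HasInfinityType K ψ e ↔
      ψ.toMonoidHom.comp (infUnitsToClass K) = infinityTypeChar K e := by
  constructor
  · intro h; ext u; exact congrArg Subtype.val (h u)
  · intro h u
    have := congrArg (fun f : (InfiniteAdeleRing K)ˣ →* Circle => f u) h
    simpa using this

/-- A continuous unitary character of `C_K` has at most one ∞-type at each complex place.
[cite: WeilBNT1967, Ch. VII §3] -/
theorem infinityType_unique_of_isComplex (ψ : IdeleClassGroup K →ₜ* Circle)
    {e e' : InfinitePlace K → ℤ} (he : HasInfinityType K ψ e) (he' : HasInfinityType K ψ e')
    {v : InfinitePlace K} (hv : v.IsComplex) : e v = e' v := by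
  apply infinityTypeChar_injective_of_isComplex K _ hv
  rw [← (hasInfinityType_iff K ψ e).mp he, ← (hasInfinityType_iff K ψ e').mp he']

/-! ### Gluing a character with a prescribed ∞-type (`H ⊔ [K_∞ˣ]`) -/

/-- **Compatibility (∞) ⇒ a character of `H ⊔ [K_∞ˣ]`.** For any subgroup `H ≤ C_K`, a character
`χ₁ : H →* S¹` and an ∞-type `e` such that `χ₁` agrees with the ∞-type character on
`H ⊓ [K_∞ˣ]`, there is a character of `B := H ⊔ [K_∞ˣ]` extending `χ₁` and equal to the ∞-type
character on `K_∞ˣ` (`Literature.GroupTheory.Subgroup.exists_monoidHom_sup_extends`).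
[cite: WeilBNT1967, Ch. VII §3] -/
theorem exists_char_sup_infUnits_of_compatible (H : Subgroup (IdeleClassGroup K))
    (χ₁ : H →* Circle) (e : InfinitePlace K → ℤ)
    (hcompat : ∀ (u : (InfiniteAdeleRing K)ˣ) (hu : infUnitsToClass K u ∈ H),
      χ₁ ⟨infUnitsToClass K u, hu⟩ = infinityTypeChar K e u) :
    ∃ χ : (H ⊔ (infUnitsToClass K).range : Subgroup (IdeleClassGroup K)) →* Circle,
      (∀ (x : IdeleClassGroup K) (hx : x ∈ H), χ ⟨x, Subgroup.mem_sup_left hx⟩ = χ₁ ⟨x, hx⟩) ∧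
      (∀ u : (InfiniteAdeleRing K)ˣ,
        χ ⟨infUnitsToClass K u, Subgroup.mem_sup_right ⟨u, rfl⟩⟩ = infinityTypeChar K e u) := by
  -- the ∞-type character kills `ker [K_∞ˣ → C_K]` (take `hu : 1 ∈ H` in `hcompat`)
  have hker : ∀ u : (InfiniteAdeleRing K)ˣ,
      infUnitsToClass K u = 1 → infinityTypeChar K e u = 1 := by
    intro u hu
    have h1 : infUnitsToClass K u ∈ H := by rw [hu]; exact H.one_mem
    rw [← hcompat u h1]
    have : (⟨infUnitsToClass K u, h1⟩ : H) = 1 := Subtype.ext hu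
    rw [this, map_one]
  obtain ⟨χ₂, hχ₂⟩ := Literature.GroupTheory.MonoidHom.exists_range_factor (infUnitsToClass K)
    (infinityTypeChar K e) hker
  have hagree : ∀ (x : IdeleClassGroup K) (h1 : x ∈ H) (h2 : x ∈ (infUnitsToClass K).range),
      χ₁ ⟨x, h1⟩ = χ₂ ⟨x, h2⟩ := by
    rintro _ h1 ⟨u, rfl⟩
    rw [hcompat u h1, ← hχ₂ u]
  obtain ⟨χ, hχ1, hχ2⟩ :=
    Literature.GroupTheory.Subgroup.exists_monoidHom_sup_extends (G := IdeleClassGroup K)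
      (M := Circle) (H₁ := H) (H₂ := (infUnitsToClass K).range) χ₁ χ₂ hagree
  exact ⟨χ, hχ1, fun u => by rw [hχ2 _ ⟨u, rfl⟩, hχ₂]⟩

/-- **Compatibility (∞) plus continuity of the glued character ⇒ extension to `C_K`.** If, in the
situation of `exists_char_sup_infUnits_of_compatible`, the glued character of `B = H ⊔ [K_∞ˣ]` is
continuous, then `χ₁` is the restriction of a continuous unitary character of `C_K` of ∞-type `e`.
[cite: WeilBNT1967, Ch. VII §3] -/
theorem exists_ideleClassChar_of_compatible (H : Subgroup (IdeleClassGroup K))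
    (χ₁ : H →* Circle) (e : InfinitePlace K → ℤ)
    (hcompat : ∀ (u : (InfiniteAdeleRing K)ˣ) (hu : infUnitsToClass K u ∈ H),
      χ₁ ⟨infUnitsToClass K u, hu⟩ = infinityTypeChar K e u)
    (hcont : ∀ χ : (H ⊔ (infUnitsToClass K).range : Subgroup (IdeleClassGroup K)) →* Circle,
      (∀ (x : IdeleClassGroup K) (hx : x ∈ H), χ ⟨x, Subgroup.mem_sup_left hx⟩ = χ₁ ⟨x, hx⟩) →
      (∀ u : (InfiniteAdeleRing K)ˣ,
        χ ⟨infUnitsToClass K u, Subgroup.mem_sup_right ⟨u, rfl⟩⟩ = infinityTypeChar K e u) →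
      Continuous χ) :
    ∃ ψ : IdeleClassGroup K →ₜ* Circle,
      HasInfinityType K ψ e ∧ ∀ (x : IdeleClassGroup K) (hx : x ∈ H), ψ x = χ₁ ⟨x, hx⟩ := by
  obtain ⟨χ, hχ1, hχ2⟩ := exists_char_sup_infUnits_of_compatible K H χ₁ e hcompat
  have hB : ∀ u : (InfiniteAdeleRing K)ˣ,
      infUnitsToClass K u ∈ (H ⊔ (infUnitsToClass K).range : Subgroup (IdeleClassGroup K)) :=
    fun u => Subgroup.mem_sup_right ⟨u, rfl⟩
  obtain ⟨ψ, hψe, hψ⟩ := exists_ideleClassChar_of_infinityType K _ hB χ (hcont χ hχ1 hχ2) e hχ2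
  exact ⟨ψ, hψe, fun x hx => by rw [← hχ1 x hx]; exact hψ ⟨x, Subgroup.mem_sup_left hx⟩⟩

end IdeleClassGroup

end Literature.NumberTheory.Automorphic

end
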